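import Mathlib.Analysis.InnerProductSpace.Laplacian
import Literature.Analysis.FluidPDE.PassiveScalarEnergyProofs
import Literature.Analysis.FluidPDE.KantorovichTransportInequality
import Literature.Analysis.FunctionSpaces.SobolevCommutatorL1
import Literature.Analysis.FunctionSpaces.TorusMollifierAllOrders
import Literature.Analysis.FunctionSpaces.TorusSobolevNormProofs
import HarnessLib

/-!
# Seis 2022, §2.2: the slice increment of the Kantorovich distance (Lemma 3 in weak form)

Analysis/FluidPDE proof-support file (everything proved). It serves the discharge of the named
facts `Literature.Analysis.FluidPDE.Seis2022_rmk1_L2` / `Seis2022_thm2_L2`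
(`SeisDissipationRateBound`): it is the time-independent heart of the estimate of
`D_δ(θ(s)) - D_δ(θ(t))` in the proof of Seis 2022, Thm. 2 (Lemma 3 integrated over `[s, t]`),
for a weak solution regularised in space by the torus mollifier `k = kernel ε`.

For one time slice — a density `θ¹ ∈ L²(T^d)`, a field `v ∈ L²(T^d; ℝ^d)` of finite spectral
enstrophy, the right-hand side of the mollified equation
`fl(x) = ∫ θ¹(y) (-⟪v(y), ∇k(x-y)⟫ + κ Δk(x-y)) dy` (the flux of `PassiveScalarEnergyMollified`),
a smooth mean-zero reference density `ρ` with an optimal log-Lipschitz potential `ζ`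
(`KantorovichLogDistance`) — we prove (`integral_mul_sliceFlux_ge`)

  `-∫ ζ fl ≤ √(C_d d)·‖ρ‖₂‖∇v‖₂ + (√d ε/δ)‖θ¹‖₂‖∇v‖₂ + δ⁻¹ S ‖v‖₁ + |κ| d c₂/(δ ε) ‖θ¹‖₁`,

where `S` bounds `|θ¹ ⋆ k - ρ|` pointwise, `‖∇v‖₂² = eGradNormSq v`, `c₂ = derivProfileMass d 2`.
The four terms are: the transport inequality for the optimal potential
(`integral_mul_inner_gradient_le_of_eGradNormSq`, the dual form of the advective part of
Seis 2022, Lemma 3); the DiPerna–Lions commutator (`lintegral_enorm_mollifyCommutator_le`);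
the mismatch between the slice `θ¹ ⋆ k` and the reference `ρ` (paid with `‖∇ζ‖ ≤ δ⁻¹`); and the
diffusive term `κ ∫ θ¹ Δ(ζ ⋆ k)` with `|Δ(ζ ⋆ k)| ≤ δ⁻¹ ε ∫|Δk| ≤ d c₂/(δε)` — the dual
replacement of the printed `(κ/δ)‖∇θ‖_{L¹}`, which avoids any regularity of `θ`.

Auxiliary identities: the pairing `∫ ζ fl = ∫ θ¹ (⟪v, ∇(ζ⋆k)⟫ + κ Δ(ζ⋆k))` (Fubini and the parity
of the kernel), and `∫ θ¹ ⟪v, ∇(ζ⋆k)⟫ = ∫ ⟪∫ θ¹(y)k(x-y) v(y) dy, ∇ζ(x)⟫ dx`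
(`∇(ζ ⋆ k) = ∫ k(· - y) ∇ζ(y) dy`, `TorusRademacher`).

## References

* C. Seis, Comm. Math. Phys. 399 (2023) = arXiv:2003.08794, §2.2: Lemma 3 and the proof of
  Thm. 2 (pp. 7–8). [`Seis2022`]
* R. J. DiPerna, P.-L. Lions, Invent. Math. 98 (1989), §II.1. [`DiPernaLions1989`]
-/

noncomputable section

open MeasureTheory Set Filter Metric Function Topology
open scoped ENNReal NNReal Topology InnerProductSpace Convolution
open Literature.Analysis.FunctionSpaces Literature.Analysis.FunctionSpaces.Torus
open Literature.Analysis.SingularIntegrals Literature.Analysis.SingularIntegrals.Torus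

namespace Literature.Analysis.FluidPDE

variable {d : Type*} [Fintype d] [DecidableEq d]

/-! ## The Laplacian of the torus kernel -/

omit [DecidableEq d] in
/-- `|Δf(z)| ≤ d · ‖D²f(z)‖` (the Laplacian is the trace of the Hessian in the standard
orthonormal basis of `ℝ^d`). [folklore] -/
theorem abs_laplacian_le_card_mul_norm_itDeriv_two (f : UnitAddTorus d → ℝ) (z : UnitAddTorus d) :
    |Torus.laplacian f z| ≤ Fintype.card d * ‖itDeriv 2 f z‖ := by
  have h := congrFun (InnerProductSpace.laplacian_eq_iteratedFDeriv_orthonormalBasis (liftAt f z)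
    (EuclideanSpace.basisFun d ℝ)) 0
  rw [Torus.laplacian, h]
  refine (Finset.abs_sum_le_sum_abs _ _).trans ?_
  calc ∑ i, |iteratedFDeriv ℝ 2 (liftAt f z) 0 ![(EuclideanSpace.basisFun d ℝ) i, (EuclideanSpace.basisFun d ℝ) i]|
      ≤ ∑ _i : d, ‖itDeriv 2 f z‖ := Finset.sum_le_sum fun i _ => by
        rw [← Real.norm_eq_abs]
        refine ((iteratedFDeriv ℝ 2 (liftAt f z) 0).le_opNorm _).trans ?_
        rw [Fin.prod_univ_two]
        simp [itDeriv]
    _ = Fintype.card d * ‖itDeriv 2 f z‖ := by simp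

omit [DecidableEq d] in
/-- `∫ |Δk_ε| ≤ d c₂ / ε²` for the torus mollifier (`c₂ = derivProfileMass d 2`). [folklore] -/
theorem integral_abs_laplacian_kernel_le {ε : ℝ} (hε : 0 < ε) (hε' : ε ≤ 1 / 4) :
    ∫ z, |Torus.laplacian (kernel (d := d) ε) z| ≤ Fintype.card d * ((ε ^ 2)⁻¹ * derivProfileMass d 2) := by
  rw [← integral_norm_itDeriv_kernel hε hε' 2, ← integral_const_mul]
  refine integral_mono ((isSmooth_kernel hε hε').laplacian.continuous.abs.integrable_unitAddTorus)
    (((continuous_itDeriv_kernel hε hε' 2).norm.const_mul _).integrable_unitAddTorus) fun z => ?_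
  exact abs_laplacian_le_card_mul_norm_itDeriv_two _ z

omit [DecidableEq d] in
/-- Off the `ε`-ball the Laplacian of the kernel vanishes: if `Δk_ε(z) ≠ 0` then `‖z‖ ≤ ε`. [folklore] -/
theorem norm_le_of_laplacian_kernel_ne_zero {ε : ℝ} (hε : 0 < ε) (hε' : ε ≤ 1 / 4) {z : UnitAddTorus d}
    (hz : Torus.laplacian (kernel ε) z ≠ 0) : ‖z‖ ≤ ε := by
  have h2 : itDeriv 2 (kernel ε) z ≠ 0 := fun h0 => hz (by
    have := abs_laplacian_le_card_mul_norm_itDeriv_two (kernel (d := d) ε) z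
    rw [h0, norm_zero, mul_zero] at this
    exact abs_eq_zero.1 (le_antisymm this (abs_nonneg _)))
  exact (norm_le_norm_reprc z).trans (norm_reprc_le_of_itDeriv_kernel_ne_zero hε hε' 2 h2)

omit [DecidableEq d] in
/-- The Laplacian of the (even) kernel is even: `Δk(x - y) = Δk(y - x)`. [folklore] -/
theorem laplacian_kernel_sub_comm {ε : ℝ} (hε : 0 < ε) (hε' : ε ≤ 1 / 4) (x y : UnitAddTorus d) :
    Torus.laplacian (kernel ε) (x - y) = Torus.laplacian (kernel ε) (y - x) := by
  have hk := isSmooth_kernel (d := d) hε hε'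
  have hfun : (fun z : UnitAddTorus d => kernel ε (0 - z)) = kernel ε := by
    funext z; rw [zero_sub, kernel_neg hε hε']
  have h := laplacian_comp_sub_left hk 0 (y - x)
  rw [hfun, zero_sub, neg_sub] at h
  exact h.symm

omit [DecidableEq d] in
/-- `∫ Δk(y - x) dx = 0`. [folklore] -/
theorem integral_laplacian_kernel_sub_eq_zero {ε : ℝ} (hε : 0 < ε) (hε' : ε ≤ 1 / 4) (y : UnitAddTorus d) :
    ∫ x, Torus.laplacian (kernel (d := d) ε) (y - x) = 0 := by
  rw [integral_sub_left_eq_self (fun z => Torus.laplacian (kernel (d := d) ε) z) volume y]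
  exact Torus.integral_laplacian_eq_zero (isSmooth_kernel hε hε')

/-! ## The diffusive term: `|Δ(ζ ⋆ k)| ≤ K ε ∫|Δk|` for Lipschitz `ζ` -/

omit [DecidableEq d] in
/-- **The Laplacian of a mollified Lipschitz function**: for `K`-Lipschitz `ζ` and `0 < ε ≤ 1/4`,
`|Δ(ζ ⋆ k_ε)(y)| ≤ K ε · d c₂/ε²` (`Δ(ζ ⋆ k) = ζ ⋆ Δk`, `∫ Δk = 0` lets one subtract `ζ(y)`, and the
kernel's Laplacian lives on the `ε`-ball). [folklore] -/
theorem abs_laplacian_convolution_kernel_le {K : NNReal} {ζ : UnitAddTorus d → ℝ} (hζ : LipschitzWith K ζ)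
    {ε : ℝ} (hε : 0 < ε) (hε' : ε ≤ 1 / 4) (y : UnitAddTorus d) :
    |Torus.laplacian (ζ ⋆ kernel ε) y| ≤
      K * ε * (Fintype.card d * ((ε ^ 2)⁻¹ * derivProfileMass d 2)) := by
  have hk := isSmooth_kernel (d := d) hε hε'
  have hζi : Integrable ζ volume := hζ.continuous.integrable_unitAddTorus
  have hLc : Continuous (Torus.laplacian (kernel (d := d) ε)) := hk.laplacian.continuous
  have hLi : Integrable (fun x => Torus.laplacian (kernel (d := d) ε) (y - x)) volume :=
    (hLc.comp (continuous_const.sub continuous_id)).integrable_unitAddTorus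
  rw [laplacian_convolution hζi hk, convolution_lsmul]
  simp only [smul_eq_mul]
  -- subtract `ζ y ∫ Δk(y - x) dx = 0`
  have e : ∫ x, ζ x * Torus.laplacian (kernel ε) (y - x) =
      ∫ x, (ζ x - ζ y) * Torus.laplacian (kernel ε) (y - x) := by
    simp_rw [sub_mul]
    have h1 : Integrable (fun x => ζ x * Torus.laplacian (kernel ε) (y - x)) volume :=
      hζi.mul_bdd (hLc.comp (continuous_const.sub continuous_id)).aestronglyMeasurable
        (Eventually.of_forall fun x => (exists_forall_norm_le_of_continuous hLc).choose_spec _)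
    rw [integral_sub h1 (hLi.const_mul _), integral_const_mul, integral_laplacian_kernel_sub_eq_zero hε hε',
      mul_zero, sub_zero]
  rw [e]
  calc |∫ x, (ζ x - ζ y) * Torus.laplacian (kernel ε) (y - x)|
      ≤ ∫ x, |(ζ x - ζ y) * Torus.laplacian (kernel ε) (y - x)| := abs_integral_le_integral_abs
    _ ≤ ∫ x, K * ε * |Torus.laplacian (kernel ε) (y - x)| := by
        refine integral_mono_of_nonneg (Eventually.of_forall fun x => abs_nonneg _)
          ((hLi.abs).const_mul _) (Eventually.of_forall fun x => ?_)
        show |(ζ x - ζ y) * Torus.laplacian (kernel ε) (y - x)| ≤ K * ε * |Torus.laplacian (kernel ε) (y - x)|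
        rw [abs_mul]
        by_cases h0 : Torus.laplacian (kernel ε) (y - x) = 0
        · simp [h0]
        · refine mul_le_mul_of_nonneg_right ?_ (abs_nonneg _)
          have hd : ‖y - x‖ ≤ ε := norm_le_of_laplacian_kernel_ne_zero hε hε' h0
          calc |ζ x - ζ y| = dist (ζ x) (ζ y) := (Real.dist_eq _ _).symm
            _ ≤ K * dist x y := hζ.dist_le_mul x y
            _ ≤ K * ε := mul_le_mul_of_nonneg_left (by rwa [dist_comm, dist_eq_norm]) K.2
    _ = K * ε * ∫ x, |Torus.laplacian (kernel ε) x| := by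
        rw [integral_const_mul, integral_sub_left_eq_self (fun z => |Torus.laplacian (kernel (d := d) ε) z|) volume y]
    _ ≤ K * ε * (Fintype.card d * ((ε ^ 2)⁻¹ * derivProfileMass d 2)) :=
        mul_le_mul_of_nonneg_left (integral_abs_laplacian_kernel_le hε hε') (by positivity)

/-! ## The pairing of the flux with a test function -/

section Pairing

variable {θ : UnitAddTorus d → ℝ} {v : UnitAddTorus d → EuclideanSpace ℝ d} {ζ : UnitAddTorus d → ℝ}
  {ε κ : ℝ}

/-- The flux of a slice, `fl(x) = ∫ θ(y) (-⟪v y, ∇k(x-y)⟫ + κ Δk(x-y)) dy` (right-hand side of the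
mollified advection–diffusion equation; `PassiveScalarEnergyMollified`). [folklore] -/
def sliceFlux (ε κ : ℝ) (θ : UnitAddTorus d → ℝ) (v : UnitAddTorus d → EuclideanSpace ℝ d)
    (x : UnitAddTorus d) : ℝ :=
  ∫ y, θ y * (-⟪v y, Torus.gradient (kernel ε) (x - y)⟫_ℝ + κ * Torus.laplacian (kernel ε) (x - y))

omit [DecidableEq d] in
/-- **Pairing the flux with a continuous test function**:
`∫ ζ(x) fl(x) dx = ∫ θ(y) (⟪v y, ∇(ζ ⋆ k)(y)⟫ + κ Δ(ζ ⋆ k)(y)) dy` for `θ ∈ L¹`, `‖v‖θ ∈ L¹`,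
continuous `ζ` (Fubini; `∇k` is odd and `Δk` even, `∇(ζ⋆k) = ζ ⋆ ∇k`, `Δ(ζ⋆k) = ζ ⋆ Δk`). [folklore] -/
theorem integral_mul_sliceFlux_eq (hθ : Integrable θ volume) (hv : AEStronglyMeasurable v volume)
    (hvθ : Integrable (fun y => ‖v y‖ * θ y) volume) (hζ : Continuous ζ) (hε : 0 < ε) (hε' : ε ≤ 1 / 4)
    (κ : ℝ) :
    ∫ x, ζ x * sliceFlux ε κ θ v x =
      ∫ y, θ y * (⟪v y, Torus.gradient (ζ ⋆ kernel ε) y⟫_ℝ + κ * Torus.laplacian (ζ ⋆ kernel ε) y) := by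
  have hk := isSmooth_kernel (d := d) hε hε'
  have hζi : Integrable ζ volume := hζ.integrable_unitAddTorus
  obtain ⟨Cζ, hCζ⟩ := exists_forall_norm_le_of_continuous hζ
  obtain ⟨C₂, hC₂⟩ := exists_forall_norm_le_of_continuous hk.gradient.continuous
  obtain ⟨C₃, hC₃⟩ := exists_forall_norm_le_of_continuous hk.laplacian.continuous
  set Fk : UnitAddTorus d → UnitAddTorus d → ℝ := fun x y =>
    -⟪v y, Torus.gradient (kernel ε) (x - y)⟫_ℝ + κ * Torus.laplacian (kernel ε) (x - y) with hFk
  -- joint integrability of `ζ x θ y Fk x y`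
  have hmeas : AEStronglyMeasurable (fun p : UnitAddTorus d × UnitAddTorus d => ζ p.1 * (θ p.2 * Fk p.1 p.2))
      (volume.prod volume) := by
    refine (hζ.comp continuous_fst).aestronglyMeasurable.mul ((hθ.1.comp_snd).mul ?_)
    refine ((hv.comp_snd.inner ?_).neg.add ?_)
    · exact (hk.gradient.continuous.comp (continuous_fst.sub continuous_snd)).aestronglyMeasurable
    · exact (continuous_const.mul (hk.laplacian.continuous.comp (continuous_fst.sub continuous_snd))).aestronglyMeasurable
  have hbound : ∀ p : UnitAddTorus d × UnitAddTorus d, ‖ζ p.1 * (θ p.2 * Fk p.1 p.2)‖ ≤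
      Cζ * (C₂ * (‖v p.2‖ * |θ p.2|) + |κ| * C₃ * |θ p.2|) := fun p => by
    rw [norm_mul, norm_mul]
    refine mul_le_mul (hCζ _) ?_ (by positivity) ((norm_nonneg _).trans (hCζ p.1))
    rw [Real.norm_eq_abs, Real.norm_eq_abs]
    have h2 : |⟪v p.2, Torus.gradient (kernel ε) (p.1 - p.2)⟫_ℝ| ≤ ‖v p.2‖ * C₂ :=
      (abs_real_inner_le_norm _ _).trans (mul_le_mul_of_nonneg_left (hC₂ _) (norm_nonneg _))
    have h3 : |κ * Torus.laplacian (kernel ε) (p.1 - p.2)| ≤ |κ| * C₃ := by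
      rw [abs_mul]
      exact mul_le_mul_of_nonneg_left (by simpa [Real.norm_eq_abs] using hC₃ (p.1 - p.2)) (abs_nonneg _)
    calc |θ p.2| * |Fk p.1 p.2| ≤ |θ p.2| * (‖v p.2‖ * C₂ + |κ| * C₃) :=
          mul_le_mul_of_nonneg_left ((abs_add_le _ _).trans (add_le_add (by rwa [abs_neg]) h3)) (abs_nonneg _)
      _ = C₂ * (‖v p.2‖ * |θ p.2|) + |κ| * C₃ * |θ p.2| := by ring
  have hbi : Integrable (fun p : UnitAddTorus d × UnitAddTorus d =>
      Cζ * (C₂ * (‖v p.2‖ * |θ p.2|) + |κ| * C₃ * |θ p.2|)) (volume.prod volume) := by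
    have h1 : Integrable (fun y => Cζ * (C₂ * (‖v y‖ * |θ y|) + |κ| * C₃ * |θ y|)) volume := by
      refine (((hvθ.norm.const_mul C₂).add (hθ.norm.const_mul (|κ| * C₃))).const_mul Cζ).congr
        (Eventually.of_forall fun y => ?_)
      simp [Real.norm_eq_abs]
    exact h1.comp_snd (volume : Measure (UnitAddTorus d))
  have hint : Integrable (fun p : UnitAddTorus d × UnitAddTorus d => ζ p.1 * (θ p.2 * Fk p.1 p.2))
      (volume.prod volume) := hbi.mono' hmeas (Eventually.of_forall hbound)
  -- Fubini
  have hswap : ∫ x, ζ x * sliceFlux ε κ θ v x = ∫ y, ∫ x, ζ x * (θ y * Fk x y) := by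
    have e1 : ∀ x, ζ x * sliceFlux ε κ θ v x = ∫ y, ζ x * (θ y * Fk x y) := fun x => by
      rw [sliceFlux, ← integral_const_mul]
    simp_rw [e1]
    exact integral_integral_swap hint
  rw [hswap]
  refine integral_congr_ae (Eventually.of_forall fun y => ?_)
  -- the inner integral at fixed `y`
  have hgi : Integrable (fun x => ζ x • Torus.gradient (kernel ε) (x - y)) volume :=
    (hζ.smul (hk.gradient.continuous.comp (continuous_id.sub continuous_const))).integrable_unitAddTorus
  have hli : Integrable (fun x => ζ x * Torus.laplacian (kernel ε) (x - y)) volume :=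
    (hζ.mul (hk.laplacian.continuous.comp (continuous_id.sub continuous_const))).integrable_unitAddTorus
  have e2 : ∀ x, ζ x * (θ y * Fk x y) =
      θ y * (-⟪v y, ζ x • Torus.gradient (kernel ε) (x - y)⟫_ℝ + κ * (ζ x * Torus.laplacian (kernel ε) (x - y))) := by
    intro x; simp only [hFk, real_inner_smul_right]; ring
  simp_rw [e2]
  rw [integral_const_mul]
  congr 1
  have hgi' : Integrable (fun x => -⟪v y, ζ x • Torus.gradient (kernel ε) (x - y)⟫_ℝ) volume :=
    (hgi.const_inner (v y)).neg
  have hli' : Integrable (fun x => κ * (ζ x * Torus.laplacian (kernel ε) (x - y))) volume := hli.const_mul κ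
  rw [integral_add hgi' hli', integral_neg, integral_const_mul, integral_inner hgi]
  -- the gradient part
  have hgrad : ∫ x, ζ x • Torus.gradient (kernel ε) (x - y) = -Torus.gradient (ζ ⋆ kernel ε) y := by
    rw [gradient_convolution hζi hk, convolution_lsmul, ← integral_neg]
    refine integral_congr_ae (Eventually.of_forall fun x => ?_)
    show ζ x • Torus.gradient (kernel ε) (x - y) = -(ζ x • Torus.gradient (kernel ε) (y - x))
    rw [Torus.gradient_kernel_sub_comm hε hε' x y, smul_neg]
  -- the Laplacian part
  have hlap : ∫ x, ζ x * Torus.laplacian (kernel ε) (x - y) = Torus.laplacian (ζ ⋆ kernel ε) y := by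
    rw [laplacian_convolution hζi hk, convolution_lsmul]
    refine integral_congr_ae (Eventually.of_forall fun x => ?_)
    show ζ x * Torus.laplacian (kernel ε) (x - y) = ζ x • Torus.laplacian (kernel ε) (y - x)
    rw [laplacian_kernel_sub_comm hε hε' x y, smul_eq_mul]
  rw [hgrad, hlap, inner_neg_right, neg_neg]

omit [DecidableEq d] in
/-- **The advective pairing through the commutator variable**: for `K`-Lipschitz `ζ`,
`θ ∈ L²`, `v ∈ L²`: `∫ θ(y) ⟪v y, ∇(ζ ⋆ k)(y)⟫ dy = ∫ ⟪∫ θ(y) k(x-y) v(y) dy, ∇ζ(x)⟫ dx`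
(`∇(ζ ⋆ k)(y) = ∫ k(y-x) ∇ζ(x) dx`, `TorusRademacher`; Fubini). [folklore] -/
theorem integral_mul_inner_gradient_convolution_eq {K : NNReal} (hζ : LipschitzWith K ζ)
    (hθ : MemLp θ 2 volume) (hv : MemLp v 2 volume) (hε : 0 < ε) (hε' : ε ≤ 1 / 4) :
    ∫ y, θ y * ⟪v y, Torus.gradient (ζ ⋆ kernel ε) y⟫_ℝ =
      ∫ x, ⟪(∫ y, (θ y * kernel ε (x - y)) • v y), Torus.gradient ζ x⟫_ℝ := by
  have hk := isSmooth_kernel (d := d) hε hε'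
  have hkc := continuous_kernel (d := d) hε hε'
  obtain ⟨Ck, hCk⟩ := exists_forall_norm_le_of_continuous hkc
  have hgm : Measurable (Torus.gradient ζ) := measurable_gradient ζ
  have hgb : ∀ x, ‖Torus.gradient ζ x‖ ≤ K := norm_gradient_le_of_lipschitz hζ
  have hθv : Integrable (fun y => θ y • v y) volume := integrable_smul_of_memLp_two hθ hv
  -- the joint integrand `θ y k(y - x) ⟪v y, ∇ζ x⟫`
  set Fj : UnitAddTorus d × UnitAddTorus d → ℝ := fun p => θ p.2 * kernel ε (p.2 - p.1) * ⟪v p.2, Torus.gradient ζ p.1⟫_ℝ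
    with hFj
  have hmeas : AEStronglyMeasurable Fj (volume.prod volume) := by
    refine ((hθ.1.comp_snd).mul ?_).mul (hv.1.comp_snd.inner (hgm.comp measurable_fst).aestronglyMeasurable)
    exact (hkc.comp (continuous_snd.sub continuous_fst)).aestronglyMeasurable
  have hint : Integrable Fj (volume.prod volume) := by
    refine ((hθv.norm.const_mul (Ck * K)).comp_snd (volume : Measure (UnitAddTorus d))).mono' hmeas
      (Eventually.of_forall fun p => ?_)
    rw [hFj, Real.norm_eq_abs, abs_mul, abs_mul, norm_smul, Real.norm_eq_abs]
    calc |θ p.2| * |kernel ε (p.2 - p.1)| * |⟪v p.2, Torus.gradient ζ p.1⟫_ℝ|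
        ≤ |θ p.2| * Ck * (‖v p.2‖ * K) := by
          refine mul_le_mul (mul_le_mul_of_nonneg_left (by simpa [Real.norm_eq_abs] using hCk (p.2 - p.1))
            (abs_nonneg _)) ((abs_real_inner_le_norm _ _).trans
              (mul_le_mul_of_nonneg_left (hgb _) (norm_nonneg _))) (abs_nonneg _)
              (mul_nonneg (abs_nonneg _) ((norm_nonneg _).trans (hCk 0)))
      _ = Ck * K * (|θ p.2| * ‖v p.2‖) := by ring
  calc ∫ y, θ y * ⟪v y, Torus.gradient (ζ ⋆ kernel ε) y⟫_ℝ
      = ∫ y, ∫ x, Fj (x, y) := by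
        refine integral_congr_ae (Eventually.of_forall fun y => ?_)
        show θ y * ⟪v y, Torus.gradient (ζ ⋆ kernel ε) y⟫_ℝ = ∫ x, Fj (x, y)
        have hi : Integrable (fun x => kernel ε (y - x) • Torus.gradient ζ x) volume := by
          refine (integrable_const ((Ck : ℝ) * K)).mono'
            ((hkc.comp (continuous_const.sub continuous_id)).aestronglyMeasurable.smul hgm.aestronglyMeasurable)
            (Eventually.of_forall fun x => ?_)
          rw [norm_smul]
          exact mul_le_mul (hCk _) (hgb x) (norm_nonneg _) ((norm_nonneg (kernel ε 0)).trans (hCk 0))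
        rw [gradient_convolution_of_lipschitz hζ hk y, ← integral_inner hi, ← integral_const_mul]
        refine integral_congr_ae (Eventually.of_forall fun x => ?_)
        simp only [hFj, real_inner_smul_right]
        ring
    _ = ∫ x, ∫ y, Fj (x, y) := (integral_integral_swap hint).symm
    _ = ∫ x, ⟪(∫ y, (θ y * kernel ε (x - y)) • v y), Torus.gradient ζ x⟫_ℝ := by
        refine integral_congr_ae (Eventually.of_forall fun x => ?_)
        show ∫ y, Fj (x, y) = ⟪(∫ y, (θ y * kernel ε (x - y)) • v y), Torus.gradient ζ x⟫_ℝ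
        rw [real_inner_comm, ← integral_inner (integrable_mul_kernel_smul hθ hv hε hε' x)]
        refine integral_congr_ae (Eventually.of_forall fun y => ?_)
        simp only [hFj, real_inner_smul_right, kernel_sub_comm hε hε' y x, real_inner_comm]

end Pairing

/-! ## Negation does not change the enstrophy -/

omit [DecidableEq d] in
/-- `eGradNormSq (-v) = eGradNormSq v`. [folklore] -/
theorem eGradNormSq_neg (v : UnitAddTorus d → EuclideanSpace ℝ d) :
    eGradNormSq (fun x => -v x) = eGradNormSq v := by
  rw [eGradNormSq_eq_tsum, eGradNormSq_eq_tsum]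
  congr 1
  refine tsum_congr fun k => ?_
  have e : EuclideanSpace.complexify ∘ (fun x => -v x) = -(EuclideanSpace.complexify ∘ v) := by
    funext x; simp [map_neg]
  rw [e, mFourierCoeff_neg, enorm_neg]

/-! ## The slice increment bound -/

section Increment

variable {θ : UnitAddTorus d → ℝ} {v : UnitAddTorus d → EuclideanSpace ℝ d} {ρ ζ : UnitAddTorus d → ℝ}
  {ε δ κ S : ℝ}

omit [DecidableEq d] in
/-- `(eLpNorm f 2).toReal = √(∫ f²)` for real `f ∈ L²`. [folklore] -/
theorem torus_toReal_eLpNorm_two_eq_sqrt {f : UnitAddTorus d → ℝ} (hf : MemLp f 2 volume) :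
    (eLpNorm f 2 volume).toReal = Real.sqrt (∫ x, f x ^ 2) := by
  rw [hf.eLpNorm_eq_integral_rpow_norm two_ne_zero ENNReal.ofNat_ne_top, ENNReal.toReal_ofReal (by positivity)]
  simp only [ENNReal.toReal_ofNat, Real.norm_eq_abs, Real.rpow_two, sq_abs]
  rw [Real.sqrt_eq_rpow, one_div]

omit [DecidableEq d] in
/-- A product bound: if `|a y| ≤ |θ y| (‖v y‖ C)` then `a` is dominated by the integrable
`C ‖‖v‖ θ‖`. [folklore] -/
theorem integrable_of_abs_le_mul_norm_mul {a : UnitAddTorus d → ℝ} (ha : AEStronglyMeasurable a volume)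
    (hθv : Integrable (fun y => ‖v y‖ * θ y) volume) {C : ℝ} (h : ∀ y, |a y| ≤ |θ y| * (‖v y‖ * C)) :
    Integrable a volume := by
  refine (hθv.norm.const_mul C).mono' ha (Eventually.of_forall fun y => ?_)
  rw [Real.norm_eq_abs, Real.norm_eq_abs, abs_mul, abs_norm]
  calc |a y| ≤ |θ y| * (‖v y‖ * C) := h y
    _ = C * (‖v y‖ * |θ y|) := by ring

/-- **The slice increment bound (Seis 2022, Lemma 3 in weak form, integrated ingredients).**
Let `0 < δ`, `0 < ε ≤ 1/4`; `θ ∈ L²(T^d)` a density slice; `v ∈ L²(T^d; ℝ^d)` with finite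
enstrophy; `ρ ∈ L²` continuous and mean-zero with an optimal log-Lipschitz potential `ζ`
(`∫ ρ ζ = krLogDist δ ρ`); `|θ ⋆ k_ε - ρ| ≤ S` pointwise. Then
`-∫ ζ fl ≤ √(∫ρ²)·√(C_d d ‖∇v‖₂²) + δ⁻¹ √d ε √(∫θ²) ‖∇v‖₂ + δ⁻¹ S ∫‖v‖ + |κ| δ⁻¹ ε (d c₂/ε²) ∫|θ|`,
`fl = sliceFlux ε κ θ v` (the four terms: transport inequality for the optimal potential,
DiPerna–Lions commutator, slice/reference mismatch, diffusion). [cite: Seis2022, Lemma 3 and proof of Thm 2, §2.2 (pp. 7–8)] -/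
theorem neg_integral_mul_sliceFlux_le (hδ : 0 < δ) (hε : 0 < ε) (hε' : ε ≤ 1 / 4)
    (hθ : MemLp θ 2 volume) (hv : MemLp v 2 volume) (hG : eGradNormSq v ≠ ∞)
    (hρ : MemLp ρ 2 volume) (hρc : Continuous ρ) (h0 : ∫ x, ρ x = 0)
    (hζ : IsLogLipschitz δ ζ) (hopt : ∫ x, ρ x * ζ x = krLogDist δ ρ)
    (hS : ∀ x, |(θ ⋆ kernel ε) x - ρ x| ≤ S) (κ : ℝ) :
    -∫ x, ζ x * sliceFlux ε κ θ v x ≤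
      Real.sqrt (∫ x, ρ x ^ 2) *
          Real.sqrt ((twoPointL2Const d).toReal * (Fintype.card d * (eGradNormSq v).toReal)) +
        δ⁻¹ * (Real.sqrt (Fintype.card d) * ε) * Real.sqrt (∫ x, θ x ^ 2) * Real.sqrt (eGradNormSq v).toReal +
        δ⁻¹ * S * (∫ x, ‖v x‖) +
        |κ| * (δ⁻¹ * ε * (Fintype.card d * ((ε ^ 2)⁻¹ * derivProfileMass d 2))) * ∫ x, |θ x| := by
  have hk := isSmooth_kernel (d := d) hε hε'
  have hkc := continuous_kernel (d := d) hε hε'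
  obtain ⟨Ck, hCk⟩ := exists_forall_norm_le_of_continuous hkc
  have hζL := hζ.lipschitzWith hδ
  have hζc : Continuous ζ := hζ.continuous hδ
  have hKval : ((Real.toNNReal δ⁻¹ : NNReal) : ℝ) = δ⁻¹ := Real.coe_toNNReal _ (inv_nonneg.2 hδ.le)
  have hθi : Integrable θ volume := hθ.integrable one_le_two
  have hvi : Integrable v volume := hv.integrable one_le_two
  have hθv' : Integrable (fun y => θ y • v y) volume := integrable_smul_of_memLp_two hθ hv
  have hθv : Integrable (fun y => ‖v y‖ * θ y) volume := by
    refine hθv'.norm.mono' (hv.1.norm.mul hθ.1) (Eventually.of_forall fun y => ?_)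
    rw [Real.norm_eq_abs, abs_mul, abs_norm, norm_smul, Real.norm_eq_abs, mul_comm]
  have hgm : Measurable (Torus.gradient ζ) := measurable_gradient ζ
  have hgb : ∀ x, ‖Torus.gradient ζ x‖ ≤ δ⁻¹ := fun x => (norm_gradient_le_of_lipschitz hζL x).trans hKval.le
  have hS0 : 0 ≤ S := (abs_nonneg _).trans (hS 0)
  -- Step 1: the pairing identity and the splitting of the two terms
  rw [integral_mul_sliceFlux_eq hθi hv.1 hθv hζc hε hε' κ]
  have hζk : IsSmooth (ζ ⋆ kernel ε) := isSmooth_convolution hζc.integrable_unitAddTorus hk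
  obtain ⟨Cg, hCg⟩ := exists_forall_norm_le_of_continuous hζk.gradient.continuous
  obtain ⟨Cl, hCl⟩ := exists_forall_norm_le_of_continuous hζk.laplacian.continuous
  have hA : Integrable (fun y => θ y * ⟪v y, Torus.gradient (ζ ⋆ kernel ε) y⟫_ℝ) volume := by
    refine integrable_of_abs_le_mul_norm_mul (C := Cg)
      (hθ.1.mul (hv.1.inner hζk.gradient.continuous.aestronglyMeasurable)) hθv fun y => ?_
    rw [abs_mul]
    exact mul_le_mul_of_nonneg_left ((abs_real_inner_le_norm _ _).trans
      (mul_le_mul_of_nonneg_left (hCg _) (norm_nonneg _))) (abs_nonneg _)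
  have hB : Integrable (fun y => θ y * (κ * Torus.laplacian (ζ ⋆ kernel ε) y)) volume :=
    hθi.mul_bdd ((continuous_const.mul hζk.laplacian.continuous).aestronglyMeasurable)
      (Eventually.of_forall fun y => (exists_forall_norm_le_of_continuous
        (continuous_const.mul hζk.laplacian.continuous)).choose_spec y)
  have esplit : ∫ y, θ y * (⟪v y, Torus.gradient (ζ ⋆ kernel ε) y⟫_ℝ + κ * Torus.laplacian (ζ ⋆ kernel ε) y) =
      (∫ y, θ y * ⟪v y, Torus.gradient (ζ ⋆ kernel ε) y⟫_ℝ) + ∫ y, θ y * (κ * Torus.laplacian (ζ ⋆ kernel ε) y) := by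
    rw [← integral_add hA hB]
    refine integral_congr_ae (Eventually.of_forall fun y => ?_)
    simp only [mul_add]
  rw [esplit, neg_add]
  refine add_le_add ?_ ?_
  · -- Step 2: the advective part
    rw [integral_mul_inner_gradient_convolution_eq hζL hθ hv hε hε']
    -- the commutator variable `W x = ∫ (θ y k(x-y)) • v y` and `comm = W - (θ ⋆ k) • v`
    set W : UnitAddTorus d → EuclideanSpace ℝ d := fun x => ∫ y, (θ y * kernel ε (x - y)) • v y with hW
    set comm : UnitAddTorus d → EuclideanSpace ℝ d := fun x => W x - (θ ⋆ kernel ε) x • v x with hcomm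
    -- measurability and integrability of `W`, `comm`
    have hWm : AEStronglyMeasurable W volume := by
      have hj : AEStronglyMeasurable (uncurry fun x y => (θ y * kernel ε (x - y)) • v y) (volume.prod volume) := by
        refine ((hθ.1.comp_snd).mul ?_).smul hv.1.comp_snd
        exact (hkc.comp (continuous_fst.sub continuous_snd)).aestronglyMeasurable
      exact hj.integral_prod_right'
    have hWb : ∀ x, ‖W x‖ ≤ Ck * ∫ y, ‖θ y • v y‖ := fun x => by
      rw [hW, ← integral_const_mul]
      refine norm_integral_le_of_norm_le (hθv'.norm.const_mul _) (Eventually.of_forall fun y => ?_)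
      rw [norm_smul, norm_mul, norm_smul]
      calc ‖θ y‖ * ‖kernel ε (x - y)‖ * ‖v y‖ = ‖kernel ε (x - y)‖ * (‖θ y‖ * ‖v y‖) := by ring
        _ ≤ Ck * (‖θ y‖ * ‖v y‖) := mul_le_mul_of_nonneg_right (hCk _) (by positivity)
    have hθk : Continuous (θ ⋆ kernel ε) := continuous_convolution hθi hkc
    have hθkv : Integrable (fun x => (θ ⋆ kernel ε) x • v x) volume := by
      obtain ⟨C, hC⟩ := exists_forall_norm_le_of_continuous hθk
      exact hvi.bdd_smul C hθk.aestronglyMeasurable (Eventually.of_forall hC)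
    have hcomm_m : AEStronglyMeasurable comm volume := hWm.sub hθkv.1
    have hcomm_lint := lintegral_enorm_mollifyCommutator_le hθ hv hε hε'
    have hcomm_i : Integrable comm volume := by
      refine ⟨hcomm_m, ?_⟩
      rw [hasFiniteIntegral_iff_enorm]
      refine lt_of_le_of_lt hcomm_lint (ENNReal.mul_lt_top (ENNReal.mul_lt_top ENNReal.ofReal_lt_top hθ.2)
        (ENNReal.rpow_lt_top_of_nonneg (by norm_num) hG))
    have hWi : Integrable W volume := by
      have e : W = fun x => comm x + (θ ⋆ kernel ε) x • v x := by funext x; simp [hcomm]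
      rw [e]; exact hcomm_i.add hθkv
    -- pairings against `∇ζ` (bounded measurable)
    have hpair : ∀ {w : UnitAddTorus d → EuclideanSpace ℝ d}, Integrable w volume →
        Integrable (fun x => ⟪w x, Torus.gradient ζ x⟫_ℝ) volume := fun {w} hw => by
      refine (hw.norm.mul_const δ⁻¹).mono' (hw.1.inner hgm.aestronglyMeasurable) (Eventually.of_forall fun x => ?_)
      rw [Real.norm_eq_abs]
      exact (abs_real_inner_le_norm _ _).trans (mul_le_mul_of_nonneg_left (hgb x) (norm_nonneg _))
    -- split `∫⟪W, ∇ζ⟫ = ∫ ρ ⟪∇ζ, v⟫ + ∫ (θ⋆k - ρ) ⟪∇ζ, v⟫ + ∫ ⟪comm, ∇ζ⟫`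
    have hρv : Integrable (fun x => ρ x * ⟪Torus.gradient ζ x, v x⟫_ℝ) volume := by
      obtain ⟨C, hC⟩ := exists_forall_norm_le_of_continuous hρc
      have h := hpair (hvi.bdd_smul C hρc.aestronglyMeasurable (Eventually.of_forall hC))
      refine h.congr (Eventually.of_forall fun x => ?_)
      show ⟪ρ x • v x, Torus.gradient ζ x⟫_ℝ = ρ x * ⟪Torus.gradient ζ x, v x⟫_ℝ
      rw [real_inner_smul_left, real_inner_comm]
    have hdv : Integrable (fun x => ((θ ⋆ kernel ε) x - ρ x) * ⟪Torus.gradient ζ x, v x⟫_ℝ) volume := by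
      have h1 := hpair hθkv
      have e : (fun x => ((θ ⋆ kernel ε) x - ρ x) * ⟪Torus.gradient ζ x, v x⟫_ℝ) =
          fun x => ⟪(θ ⋆ kernel ε) x • v x, Torus.gradient ζ x⟫_ℝ - ρ x * ⟪Torus.gradient ζ x, v x⟫_ℝ := by
        funext x; rw [real_inner_smul_left, real_inner_comm, sub_mul]
      rw [e]; exact h1.sub hρv
    have esum : ∫ x, ⟪W x, Torus.gradient ζ x⟫_ℝ =
        (∫ x, ρ x * ⟪Torus.gradient ζ x, v x⟫_ℝ) +
          (∫ x, ⟪comm x, Torus.gradient ζ x⟫_ℝ) +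
          ∫ x, ((θ ⋆ kernel ε) x - ρ x) * ⟪Torus.gradient ζ x, v x⟫_ℝ := by
      have h12 : Integrable (fun x => ρ x * ⟪Torus.gradient ζ x, v x⟫_ℝ + ⟪comm x, Torus.gradient ζ x⟫_ℝ) volume :=
        hρv.add (hpair hcomm_i)
      rw [← integral_add hρv (hpair hcomm_i), ← integral_add h12 hdv]
      refine integral_congr_ae (Eventually.of_forall fun x => ?_)
      show ⟪W x, Torus.gradient ζ x⟫_ℝ = ρ x * ⟪Torus.gradient ζ x, v x⟫_ℝ +
        ⟪comm x, Torus.gradient ζ x⟫_ℝ + ((θ ⋆ kernel ε) x - ρ x) * ⟪Torus.gradient ζ x, v x⟫_ℝ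
      have e : W x = comm x + (θ ⋆ kernel ε) x • v x := by simp [hcomm]
      rw [e, inner_add_left, real_inner_smul_left, real_inner_comm (v x)]
      ring
    rw [esum, neg_add, neg_add]
    refine add_le_add (add_le_add ?_ ?_) ?_
    · -- the transport inequality for the optimal potential, field `-v`
      have hnegv : MemLp (fun x => -v x) 2 volume := hv.neg
      have h := integral_mul_inner_gradient_le_of_eGradNormSq hδ hρ h0 hζ hopt hnegv
        (by rw [eGradNormSq_neg]; exact hG)
      rw [eGradNormSq_neg] at h
      have e : ∫ x, ρ x * ⟪Torus.gradient ζ x, -v x⟫_ℝ = -∫ x, ρ x * ⟪Torus.gradient ζ x, v x⟫_ℝ := by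
        rw [← integral_neg]
        refine integral_congr_ae (Eventually.of_forall fun x => ?_)
        simp only [inner_neg_right, mul_neg]
      rwa [e] at h
    · -- the commutator
      rw [← integral_neg]
      calc ∫ x, -⟪comm x, Torus.gradient ζ x⟫_ℝ ≤ ∫ x, δ⁻¹ * ‖comm x‖ := by
            refine integral_mono (hpair hcomm_i).neg (hcomm_i.norm.const_mul _) fun x => ?_
            show -⟪comm x, Torus.gradient ζ x⟫_ℝ ≤ δ⁻¹ * ‖comm x‖
            calc -⟪comm x, Torus.gradient ζ x⟫_ℝ ≤ |⟪comm x, Torus.gradient ζ x⟫_ℝ| := neg_le_abs _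
              _ ≤ ‖comm x‖ * ‖Torus.gradient ζ x‖ := abs_real_inner_le_norm _ _
              _ ≤ ‖comm x‖ * δ⁻¹ := mul_le_mul_of_nonneg_left (hgb x) (norm_nonneg _)
              _ = δ⁻¹ * ‖comm x‖ := mul_comm _ _
        _ = δ⁻¹ * ∫ x, ‖comm x‖ := integral_const_mul _ _
        _ ≤ δ⁻¹ * ((Real.sqrt (Fintype.card d) * ε) * Real.sqrt (∫ x, θ x ^ 2) *
              Real.sqrt (eGradNormSq v).toReal) := by
            refine mul_le_mul_of_nonneg_left ?_ (inv_nonneg.2 hδ.le)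
            rw [integral_norm_eq_lintegral_enorm hcomm_m]
            have hfin : ENNReal.ofReal (Real.sqrt (Fintype.card d) * ε) * eLpNorm θ 2 volume *
                eGradNormSq v ^ (1 / 2 : ℝ) ≠ ∞ :=
              (ENNReal.mul_lt_top (ENNReal.mul_lt_top ENNReal.ofReal_lt_top hθ.2)
                (ENNReal.rpow_lt_top_of_nonneg (by norm_num) hG)).ne
            refine (ENNReal.toReal_mono hfin hcomm_lint).trans (le_of_eq ?_)
            rw [ENNReal.toReal_mul, ENNReal.toReal_mul, ENNReal.toReal_ofReal (by positivity),
              torus_toReal_eLpNorm_two_eq_sqrt hθ, ← ENNReal.toReal_rpow, Real.sqrt_eq_rpow (eGradNormSq v).toReal]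
        _ = δ⁻¹ * (Real.sqrt (Fintype.card d) * ε) * Real.sqrt (∫ x, θ x ^ 2) *
              Real.sqrt (eGradNormSq v).toReal := by ring
    · -- the mismatch `θ ⋆ k - ρ`, paid with `‖∇ζ‖ ≤ δ⁻¹`
      rw [← integral_neg]
      have hb : Integrable (fun x => δ⁻¹ * S * ‖v x‖) volume := hvi.norm.const_mul _
      rw [show δ⁻¹ * S * ∫ x, ‖v x‖ = ∫ x, δ⁻¹ * S * ‖v x‖ from (integral_const_mul _ _).symm]
      refine integral_mono hdv.neg hb fun x => ?_
      show -(((θ ⋆ kernel ε) x - ρ x) * ⟪Torus.gradient ζ x, v x⟫_ℝ) ≤ δ⁻¹ * S * ‖v x‖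
      calc -(((θ ⋆ kernel ε) x - ρ x) * ⟪Torus.gradient ζ x, v x⟫_ℝ)
          ≤ |((θ ⋆ kernel ε) x - ρ x) * ⟪Torus.gradient ζ x, v x⟫_ℝ| := neg_le_abs _
        _ = |(θ ⋆ kernel ε) x - ρ x| * |⟪Torus.gradient ζ x, v x⟫_ℝ| := abs_mul _ _
        _ ≤ S * (δ⁻¹ * ‖v x‖) := mul_le_mul (hS x) ((abs_real_inner_le_norm _ _).trans
            (mul_le_mul_of_nonneg_right (hgb x) (norm_nonneg _))) (abs_nonneg _) hS0
        _ = δ⁻¹ * S * ‖v x‖ := by ring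
  · -- Step 3: the diffusive part
    rw [← integral_neg]
    have hLb : ∀ y, |Torus.laplacian (ζ ⋆ kernel ε) y| ≤
        δ⁻¹ * ε * (Fintype.card d * ((ε ^ 2)⁻¹ * derivProfileMass d 2)) := fun y => by
      have h := abs_laplacian_convolution_kernel_le hζL hε hε' y
      rwa [hKval] at h
    have hb : Integrable (fun y => |κ| * (δ⁻¹ * ε * (Fintype.card d * ((ε ^ 2)⁻¹ * derivProfileMass d 2))) * |θ y|)
        volume := hθi.abs.const_mul _
    rw [show |κ| * (δ⁻¹ * ε * (Fintype.card d * ((ε ^ 2)⁻¹ * derivProfileMass d 2))) * ∫ x, |θ x| =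
        ∫ x, |κ| * (δ⁻¹ * ε * (Fintype.card d * ((ε ^ 2)⁻¹ * derivProfileMass d 2))) * |θ x| from
      (integral_const_mul _ _).symm]
    refine integral_mono hB.neg hb fun y => ?_
    show -(θ y * (κ * Torus.laplacian (ζ ⋆ kernel ε) y)) ≤
      |κ| * (δ⁻¹ * ε * (Fintype.card d * ((ε ^ 2)⁻¹ * derivProfileMass d 2))) * |θ y|
    calc -(θ y * (κ * Torus.laplacian (ζ ⋆ kernel ε) y)) ≤ |θ y * (κ * Torus.laplacian (ζ ⋆ kernel ε) y)| :=
          neg_le_abs _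
      _ = |θ y| * (|κ| * |Torus.laplacian (ζ ⋆ kernel ε) y|) := by rw [abs_mul, abs_mul]
      _ ≤ |θ y| * (|κ| * (δ⁻¹ * ε * (Fintype.card d * ((ε ^ 2)⁻¹ * derivProfileMass d 2)))) :=
          mul_le_mul_of_nonneg_left (mul_le_mul_of_nonneg_left (hLb y) (abs_nonneg _)) (abs_nonneg _)
      _ = _ := by ring

end Increment

end Literature.Analysis.FluidPDE
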